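import Literature.Geometry.Riemannian.SelfDualMetric
import Literature.Geometry.Riemannian.CurvatureDecompositionProofs
import Literature.Geometry.Lorentzian.MetricDetComparison
import HarnessLib

/-!
# Self-duality is frame independent: one positive orthonormal frame per point suffices

Companion *proofs* file (theorems only: no definition, no named fact) of
`Literature/Geometry/Riemannian/SelfDualMetric.lean`, which defines, for a metric `g` on a smooth
4-manifold with `[g.HasLeviCivita]` and a smooth orientation `o`, `g.IsSelfDualWith o` ("`W⁻ ≡ 0`":
Hamilton's block `C = (R(ψᵢ, ψⱼ))` of the Levi-Civita curvature is the scalar matrix `(tr C/3)·1`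
in EVERY positively `o`-oriented `g`-orthonormal frame) and lists as its first follow-up the
**frame independence at a point** ("for one frame per point it is the same condition, by
`SO(3)`-equivariance of `C` — not proved here"). This file proves it:

* `isSelfDualWith_iff_forall_exists` — for a Riemannian `g`: `g.IsSelfDualWith o` iff at every
  point SOME positively `o`-oriented `g`-orthonormal frame has scalar block `C`;
  `isSelfDualWith_of_forall_exists` (the useful direction, no Riemannian hypothesis),
  `isSelfDualWith_neg_of_forall_exists` (anti-self-duality through the block `A`), and the
  general-connection forms `isSelfDualWithOf_iff_forall_exists` / `…_of_forall_exists`;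
* `blockC_eq_trace_div_smul_one_of_isPosFrame`, `blockA_eq_trace_div_smul_one_of_isPosFrame` —
  at a point, two positively oriented orthonormal frames agree on whether `C` (resp. `A`) is
  scalar (`blockC_eq_trace_div_smul_one_iff_of_isPosFrame`);
* `exists_blockC_eq_conj` — the mechanism, for any Levi-Civita connection of a `C^n` metric
  (`n ≥ 2`) on a manifold modelled on a `4`-dimensional space: if two `g_x`-orthonormal frames
  `e, e'` give the same sign to some alternating `4`-form (same orientation), then
  `C(e') = Pᵀ C(e) P` with `P Pᵀ = 1`.

## The argument (Besse 1987, 1.126–1.128: the blocks are `SO(4)`-modules; frame-wise)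

The orthonormal frames of one orientation at `x` form an `SO(4)`-torsor, and `SO(4)` is generated
by the Givens rotations in the coordinate planes `(0,1)`, `(1,2)`, `(2,3)`. Concretely:

1. **Each Givens rotation of the frame conjugates `C` by a rotation of `Λ²₋ ≅ ℝ³`**
   (`blockC_frame_rot23`, `blockC_frame_rot12`, `blockC_frame_rot01`; e.g. for
   `e₂' = c e₂ + s e₃`, `e₃' = -s e₂ + c e₃`: `ψ₀' = ψ₀`, `ψ₁' = c ψ₁ + s ψ₂`, `ψ₂' = -s ψ₁ + c ψ₂`
   for Hamilton's `ψ₀ = e₀∧e₁ + e₃∧e₂`, `ψ₁ = e₀∧e₂ + e₁∧e₃`, `ψ₂ = e₀∧e₃ + e₂∧e₁`, 1997, p. 5),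
   proved entrywise from the multilinearity and the symmetries of `g(R(·,·)·,·)` exactly as the
   tree's `blockA_frame_rot23/12` (`CurvatureDecompositionProofs.lean`); it preserves
   orthonormality (`IsOrthonormalFrame.frame_rot01`, tree `frame_rot12/23`) and every alternating
   `4`-form (`AlternatingMap.map_update_rotate`: the form is multiplied by `c² + s² = 1`).
2. **Six rotations join `e` to `e'` up to the sign of one vector** (`exists_blockC_eq_conj`):
   expanding in the orthonormal basis `f` (`IsOrthonormalFrame.eq_sum_smul`, `dim = 4`), a
   rotation with parameters `(b, -a)/√(a² + b²)` kills the coordinate `a = g(v, fᵢ)` of a vector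
   `v` and makes the next one non-negative (`exists_circle_annihilate`); three rotations bring
   `e'₃` to the last position (a unit vector with coordinates `(0,0,0,≥0)` is `f₃`,
   `IsOrthonormalFrame.eq_of_coords`), two more bring `e'₂` to position `2`, one more `e'₁` to
   position `1`, after which `e'₀ = ±f₀` (`eq_or_eq_neg_of_coords`); the minus sign would reverse
   the alternating form, contradicting the orientation hypothesis.
3. Orthogonal conjugation preserves "scalar" and the trace
   (`Matrix.eq_trace_div_smul_one_of_conj`); on a 4-manifold the orientation character
   `SmoothOrientation.IsPosFrame` of `OrientationSign.lean` is the sign of such an alternating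
   form (`exists_alternating_pos_of_isPosFrame`), positive orthonormal frames exist for a Riemannian
   metric (`exists_isOrthonormalFrame_isPosFrame`, from `exists_orthonormal_basis` of
   `MetricDetComparison.lean` and the reversal of one vector), and the block `A` is the block `C`
   of the frame `e ∘ (2 3)` of the opposite orientation (`blockC_comp_swap`, `SelfDualMetric.lean`).

Still not here (the other two follow-ups of `SelfDualMetric.lean`): conformal invariance of
`IsSelfDualWith` and "locally conformally flat ⟹ self-dual for both orientations"; both need the
conformal transformation law of the full curvature tensor on a manifold.

## References

* A. L. Besse, *Einstein Manifolds* (1987), 1.126–1.128 (`SO(4)`-decomposition of curvature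
  tensors, `W = W⁺ + W⁻`, the block form `R = (W⁺ + s/12, Z; ᵗZ, W⁻ + s/12)`), 13.5–13.6 and
  Def. 13.16 (half conformally flat: `W⁻ = 0`). [Besse1987]
* M. F. Atiyah, N. J. Hitchin, I. M. Singer, *Self-duality in four-dimensional Riemannian
  geometry*, Proc. R. Soc. Lond. A 362 (1978) 425–461, §1. [AtiyahHitchinSinger1978]
* R. S. Hamilton, *Four-manifolds with positive isotropic curvature*, Comm. Anal. Geom. 5 (1997),
  §1.2, p. 5 (the bases `φᵢ`, `ψᵢ` and the blocks `A`, `B`, `C`). [Hamilton1997]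
-/

noncomputable section

open Bundle Finset Function Module
open scoped Manifold ContDiff Topology BigOperators Matrix

namespace Literature.Geometry.Riemannian

open Lorentzian Lorentzian.PseudoRiemannianMetric

section Algebra

variable {E : Type*} [NormedAddCommGroup E] [NormedSpace ℝ E] {H : Type*} [TopologicalSpace H]
  {I : ModelWithCorners ℝ E H} {M : Type*} [TopologicalSpace M] [ChartedSpace H M]
  [IsManifold I ∞ M] {n : ℕ∞ω} [FiniteDimensional ℝ E] [CompleteSpace E]
  {g : PseudoRiemannianMetric I n E (TangentSpace I : M → Type _)}
  {cov : CovariantDerivative I E (TangentSpace I : M → Type _)}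

-- nine entries, each a few hundred curvature monomials: the default heartbeat budget is too small
set_option maxHeartbeats 800000 in
/-- **A rotation of the frame in the `(e₂, e₃)`-plane conjugates Hamilton's block `C` by the
rotation of `Λ²₋ ≅ ℝ³` about the `ψ₁`-axis** (indices from `0`): with `e₂' = c e₂ + s e₃`,
`e₃' = -s e₂ + c e₃`, `c² + s² = 1`, one has `ψ₀' = ψ₀`, `ψ₁' = c ψ₁ + s ψ₂`, `ψ₂' = -s ψ₁ + c ψ₂`
for Hamilton's anti-self-dual 2-vectors `ψ₀ = e₀∧e₁ + e₃∧e₂`, `ψ₁ = e₀∧e₂ + e₁∧e₃`,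
`ψ₂ = e₀∧e₃ + e₂∧e₁` (1997, p. 5), hence `C(e') = ρᵀ C(e) ρ` with the same rotation matrix `ρ` as
for the block `A` (`blockA_frame_rot23`). Levi-Civita `cov` of a `C^n` metric, `n ≥ 2`.
[cite: Hamilton1997, §1.2, p. 5] -/
theorem blockC_frame_rot23 (h : g.IsLeviCivita cov) (hn : 2 ≤ n) (x : M)
    (e : Fin 4 → TangentSpace I x) {c s : ℝ} (hcs : c ^ 2 + s ^ 2 = 1) :
    g.blockC cov x ![e 0, e 1, c • e 2 + s • e 3, -s • e 2 + c • e 3] =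
      (!![1, 0, 0; 0, c, -s; 0, s, c])ᵀ * g.blockC cov x e * !![1, 0, 0; 0, c, -s; 0, s, c] := by
  -- the rotated pair `(e₃', e₂')` is `(e₃, e₂)` as a 2-vector
  have L1 : ∀ Z W : TangentSpace I x,
      g.val x (cov.curvature x (-s • e 2 + c • e 3) (c • e 2 + s • e 3) Z) W =
        g.val x (cov.curvature x (e 3) (e 2) Z) W := by
    intro Z W
    have hA := val_curvature_antisymm (g := g) (cov := cov) x (e 2) (e 3) Z W
    simp only [map_add, map_smul, _root_.add_apply, _root_.smul_apply, smul_eq_mul,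
      CovariantDerivative.curvature_self, _root_.zero_apply, map_zero]
    linear_combination (g.val x (cov.curvature x (e 3) (e 2) Z) W) * hcs + (- (s * s)) * hA
  have L1' : ∀ X Y : TangentSpace I x,
      g.val x (cov.curvature x X Y (c • e 2 + s • e 3)) (-s • e 2 + c • e 3) =
        g.val x (cov.curvature x X Y (e 2)) (e 3) := by
    intro X Y
    have hS := h.val_curvature_skew hn x X Y (e 2) (e 3)
    have h2 := val_curvature_self34 h hn x X Y (e 2)
    have h3 := val_curvature_self34 h hn x X Y (e 3)
    simp only [map_add, map_smul, _root_.add_apply, _root_.smul_apply, smul_eq_mul]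
    linear_combination (g.val x (cov.curvature x X Y (e 2)) (e 3)) * hcs + (- (s * s)) * hS +
      (-(c * s)) * h2 + (c * s) * h3
  ext i j
  fin_cases i <;> fin_cases j <;>
  · simp only [Fin.zero_eta, Fin.mk_one, Fin.reduceFinMk, Fin.isValue, blockC, pairingCurvature,
      bivectorCurvature, curvatureForm, antiSelfDualPairs, Matrix.of_apply, Fin.sum_univ_two,
      Fin.sum_univ_three, Matrix.mul_apply, Matrix.transpose_apply, Matrix.cons_val',
      Matrix.cons_val, Matrix.empty_val', Matrix.cons_val_fin_one, L1, L1']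
    (try simp only [map_add, map_smul, _root_.add_apply, _root_.smul_apply, smul_eq_mul])
    simp (disch := decide) only [val_curvature_frame_swap12 x e,
      val_curvature_frame_swap34 h hn x e]
    ring

-- nine entries, each a few hundred curvature monomials: the default heartbeat budget is too small
set_option maxHeartbeats 800000 in
/-- **A rotation of the frame in the `(e₁, e₂)`-plane conjugates `C` by the rotation of `Λ²₋`
about the `ψ₂`-axis**: with `e₁' = c e₁ + s e₂`, `e₂' = -s e₁ + c e₂`, `c² + s² = 1`, one has
`ψ₀' = c ψ₀ + s ψ₁`, `ψ₁' = -s ψ₀ + c ψ₁`, `ψ₂' = ψ₂`, hence `C(e') = ρᵀ C(e) ρ` with the same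
rotation matrix `ρ` as for the block `A` (`blockA_frame_rot12`). [cite: Hamilton1997, §1.2, p. 5] -/
theorem blockC_frame_rot12 (h : g.IsLeviCivita cov) (hn : 2 ≤ n) (x : M)
    (e : Fin 4 → TangentSpace I x) {c s : ℝ} (hcs : c ^ 2 + s ^ 2 = 1) :
    g.blockC cov x ![e 0, c • e 1 + s • e 2, -s • e 1 + c • e 2, e 3] =
      (!![c, -s, 0; s, c, 0; 0, 0, 1])ᵀ * g.blockC cov x e * !![c, -s, 0; s, c, 0; 0, 0, 1] := by
  -- the rotated pair `(e₂', e₁')` is `(e₂, e₁)` as a 2-vector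
  have L1 : ∀ Z W : TangentSpace I x,
      g.val x (cov.curvature x (-s • e 1 + c • e 2) (c • e 1 + s • e 2) Z) W =
        g.val x (cov.curvature x (e 2) (e 1) Z) W := by
    intro Z W
    have hA := val_curvature_antisymm (g := g) (cov := cov) x (e 1) (e 2) Z W
    simp only [map_add, map_smul, _root_.add_apply, _root_.smul_apply, smul_eq_mul,
      CovariantDerivative.curvature_self, _root_.zero_apply, map_zero]
    linear_combination (g.val x (cov.curvature x (e 2) (e 1) Z) W) * hcs + (- (s * s)) * hA
  have L1' : ∀ X Y : TangentSpace I x,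
      g.val x (cov.curvature x X Y (c • e 1 + s • e 2)) (-s • e 1 + c • e 2) =
        g.val x (cov.curvature x X Y (e 1)) (e 2) := by
    intro X Y
    have hS := h.val_curvature_skew hn x X Y (e 1) (e 2)
    have h2 := val_curvature_self34 h hn x X Y (e 1)
    have h3 := val_curvature_self34 h hn x X Y (e 2)
    simp only [map_add, map_smul, _root_.add_apply, _root_.smul_apply, smul_eq_mul]
    linear_combination (g.val x (cov.curvature x X Y (e 1)) (e 2)) * hcs + (- (s * s)) * hS +
      (-(c * s)) * h2 + (c * s) * h3
  ext i j
  fin_cases i <;> fin_cases j <;>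
  · simp only [Fin.zero_eta, Fin.mk_one, Fin.reduceFinMk, Fin.isValue, blockC, pairingCurvature,
      bivectorCurvature, curvatureForm, antiSelfDualPairs, Matrix.of_apply, Fin.sum_univ_two,
      Fin.sum_univ_three, Matrix.mul_apply, Matrix.transpose_apply, Matrix.cons_val',
      Matrix.cons_val, Matrix.empty_val', Matrix.cons_val_fin_one, L1, L1']
    (try simp only [map_add, map_smul, _root_.add_apply, _root_.smul_apply, smul_eq_mul])
    simp (disch := decide) only [val_curvature_frame_swap12 x e,
      val_curvature_frame_swap34 h hn x e]
    ring

-- nine entries, each a few hundred curvature monomials: the default heartbeat budget is too small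
set_option maxHeartbeats 800000 in
/-- **A rotation of the frame in the `(e₀, e₁)`-plane conjugates `C` by a rotation of `Λ²₋` about
the `ψ₀`-axis**: with `e₀' = c e₀ + s e₁`, `e₁' = -s e₀ + c e₁`, `c² + s² = 1`, one has
`ψ₀' = ψ₀`, `ψ₁' = c ψ₁ - s ψ₂`, `ψ₂' = s ψ₁ + c ψ₂` (`e₀'∧e₁' = e₀∧e₁`), hence
`C(e') = ρᵀ C(e) ρ` with `ρ` the displayed rotation matrix (Hamilton 1997, p. 5, bases of `Λ²₋`).
[cite: Hamilton1997, §1.2, p. 5] -/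
theorem blockC_frame_rot01 (h : g.IsLeviCivita cov) (hn : 2 ≤ n) (x : M)
    (e : Fin 4 → TangentSpace I x) {c s : ℝ} (hcs : c ^ 2 + s ^ 2 = 1) :
    g.blockC cov x ![c • e 0 + s • e 1, -s • e 0 + c • e 1, e 2, e 3] =
      (!![1, 0, 0; 0, c, s; 0, -s, c])ᵀ * g.blockC cov x e * !![1, 0, 0; 0, c, s; 0, -s, c] := by
  -- the rotated pair `(e₀', e₁')` is `(e₀, e₁)` as a 2-vector
  have L1 : ∀ Z W : TangentSpace I x,
      g.val x (cov.curvature x (c • e 0 + s • e 1) (-s • e 0 + c • e 1) Z) W =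
        g.val x (cov.curvature x (e 0) (e 1) Z) W := by
    intro Z W
    have hA := val_curvature_antisymm (g := g) (cov := cov) x (e 1) (e 0) Z W
    simp only [map_add, map_smul, _root_.add_apply, _root_.smul_apply, smul_eq_mul,
      CovariantDerivative.curvature_self, _root_.zero_apply, map_zero]
    linear_combination (g.val x (cov.curvature x (e 0) (e 1) Z) W) * hcs + (- (s * s)) * hA
  have L1' : ∀ X Y : TangentSpace I x,
      g.val x (cov.curvature x X Y (-s • e 0 + c • e 1)) (c • e 0 + s • e 1) =
        g.val x (cov.curvature x X Y (e 1)) (e 0) := by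
    intro X Y
    have hS := h.val_curvature_skew hn x X Y (e 0) (e 1)
    have h2 := val_curvature_self34 h hn x X Y (e 0)
    have h3 := val_curvature_self34 h hn x X Y (e 1)
    simp only [map_add, map_smul, _root_.add_apply, _root_.smul_apply, smul_eq_mul]
    linear_combination (g.val x (cov.curvature x X Y (e 1)) (e 0)) * hcs + (- (s * s)) * hS +
      (-(c * s)) * h2 + (c * s) * h3
  ext i j
  fin_cases i <;> fin_cases j <;>
  · simp only [Fin.zero_eta, Fin.mk_one, Fin.reduceFinMk, Fin.isValue, blockC, pairingCurvature,
      bivectorCurvature, curvatureForm, antiSelfDualPairs, Matrix.of_apply, Fin.sum_univ_two,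
      Fin.sum_univ_three, Matrix.mul_apply, Matrix.transpose_apply, Matrix.cons_val',
      Matrix.cons_val, Matrix.empty_val', Matrix.cons_val_fin_one, L1, L1']
    (try simp only [map_add, map_smul, _root_.add_apply, _root_.smul_apply, smul_eq_mul])
    simp (disch := decide) only [val_curvature_frame_swap12 x e,
      val_curvature_frame_swap34 h hn x e]
    ring

/-! ### Orthonormality of the rotated frames -/

omit [FiniteDimensional ℝ E] [CompleteSpace E] in
/-- Rotating an orthonormal 4-frame in the `(e₀, e₁)`-plane (`c² + s² = 1`) gives an orthonormal
frame (companion of `IsOrthonormalFrame.frame_rot12/23`). [folklore] -/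
theorem _root_.Literature.Geometry.Lorentzian.PseudoRiemannianMetric.IsOrthonormalFrame.frame_rot01 {x : M} {e : Fin 4 → TangentSpace I x}
    (he : g.IsOrthonormalFrame x e) {c s : ℝ} (hcs : c ^ 2 + s ^ 2 = 1) :
    g.IsOrthonormalFrame x ![c • e 0 + s • e 1, -s • e 0 + c • e 1, e 2, e 3] := by
  obtain ⟨h1, h2⟩ := he
  have h01 := h2 0 1 (by decide); have h02 := h2 0 2 (by decide); have h03 := h2 0 3 (by decide)
  have h10 := h2 1 0 (by decide); have h12 := h2 1 2 (by decide); have h13 := h2 1 3 (by decide)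
  have h20 := h2 2 0 (by decide); have h21 := h2 2 1 (by decide); have h23 := h2 2 3 (by decide)
  have h30 := h2 3 0 (by decide); have h31 := h2 3 1 (by decide); have h32 := h2 3 2 (by decide)
  refine ⟨fun i ↦ ?_, fun i j hij ↦ ?_⟩
  · fin_cases i <;>
    · simp only [Fin.zero_eta, Fin.mk_one, Fin.reduceFinMk, Fin.isValue, Matrix.cons_val,
        map_add, map_smul, _root_.add_apply, _root_.smul_apply, smul_eq_mul, h1 0, h1 1, h1 2,
        h1 3, h01, h10]
      try linear_combination hcs
  · fin_cases i <;> fin_cases j <;>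
      first
      | exact absurd rfl hij
      | (simp only [Fin.zero_eta, Fin.mk_one, Fin.reduceFinMk, Fin.isValue, Matrix.cons_val,
          map_add, map_smul, _root_.add_apply, _root_.smul_apply, smul_eq_mul, h1 0, h1 1, h01,
          h02, h03, h10, h12, h13, h20, h21, h23, h30, h31, h32]
         try ring)

end Algebra

/-! ### Plane rotations and alternating forms -/

section Alternating

variable {ι : Type*} [DecidableEq ι] {V W : Type*} [AddCommGroup V] [Module ℝ V]
  [AddCommGroup W] [Module ℝ W]

/-- **A plane rotation of two vectors of a family multiplies every alternating form by
`c² + s²`**: `vol(…, c vᵢ + s vⱼ, …, -s vᵢ + c vⱼ, …) = (c² + s²) vol(v)`. In particular Givens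
rotations (`c² + s² = 1`) of a frame preserve its orientation character. [folklore] -/
theorem _root_.AlternatingMap.map_update_rotate (vol : V [⋀^ι]→ₗ[ℝ] W) (v : ι → V) {i j : ι}
    (hij : i ≠ j) (c s : ℝ) :
    vol (update (update v i (c • v i + s • v j)) j (-s • v i + c • v j)) = (c ^ 2 + s ^ 2) • vol v := by
  have hji : j ≠ i := hij.symm
  -- the second vector, slot `j`
  have e2 : update (update v i (c • v i + s • v j)) j (v j) = update v i (c • v i + s • v j) :=
    update_eq_self_iff.2 (update_of_ne hji _ _).symm
  have t2 : vol (update v i (c • v i + s • v j)) = c • vol v := by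
    rw [vol.map_update_add, vol.map_update_smul, vol.map_update_smul, update_eq_self,
      vol.map_update_self _ hij, smul_zero, add_zero]
  have e1 : update (update v i (c • v i + s • v j)) j (v i) =
      update (update v j (v i)) i (c • v i + s • v j) := update_comm hij _ _ _
  have z1 : vol (update (update v j (v i)) i (v i)) = 0 := by
    rw [update_comm hji, update_eq_self, vol.map_update_self _ hji]
  have z2 : vol (update (update v j (v i)) i (v j)) = -vol v := by
    rw [← Equiv.comp_swap_eq_update, vol.map_swap _ hij]
  have t1 : vol (update (update v j (v i)) i (c • v i + s • v j)) = -(s • vol v) := by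
    rw [vol.map_update_add, vol.map_update_smul, vol.map_update_smul, z1, z2, smul_zero, zero_add,
      smul_neg]
  rw [vol.map_update_add, vol.map_update_smul, vol.map_update_smul, e1, t1, e2, t2, smul_neg, smul_smul,
    smul_smul, add_smul]
  simp only [sq, neg_mul, neg_smul, neg_neg]
  abel

/-- The frame `(v₀, v₁, c v₂ + s v₃, -s v₂ + c v₃)` as a double update of `v`. [folklore] -/
theorem frame_rot23_eq_update (v : Fin 4 → V) (c s : ℝ) :
    ![v 0, v 1, c • v 2 + s • v 3, -s • v 2 + c • v 3] =
      update (update v 2 (c • v 2 + s • v 3)) 3 (-s • v 2 + c • v 3) := by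
  funext k
  fin_cases k <;> simp

/-- The frame `(v₀, c v₁ + s v₂, -s v₁ + c v₂, v₃)` as a double update of `v`. [folklore] -/
theorem frame_rot12_eq_update (v : Fin 4 → V) (c s : ℝ) :
    ![v 0, c • v 1 + s • v 2, -s • v 1 + c • v 2, v 3] =
      update (update v 1 (c • v 1 + s • v 2)) 2 (-s • v 1 + c • v 2) := by
  funext k
  fin_cases k <;> simp

/-- The frame `(c v₀ + s v₁, -s v₀ + c v₁, v₂, v₃)` as a double update of `v`. [folklore] -/
theorem frame_rot01_eq_update (v : Fin 4 → V) (c s : ℝ) :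
    ![c • v 0 + s • v 1, -s • v 0 + c • v 1, v 2, v 3] =
      update (update v 0 (c • v 0 + s • v 1)) 1 (-s • v 0 + c • v 1) := by
  funext k
  fin_cases k <;> simp

/-- Givens rotations in the `(2, 3)`-plane preserve every alternating `4`-form. [folklore] -/
theorem _root_.AlternatingMap.map_frame_rot23 (vol : V [⋀^Fin 4]→ₗ[ℝ] W) (v : Fin 4 → V) {c s : ℝ}
    (hcs : c ^ 2 + s ^ 2 = 1) : vol ![v 0, v 1, c • v 2 + s • v 3, -s • v 2 + c • v 3] = vol v := by
  rw [frame_rot23_eq_update, vol.map_update_rotate v (by decide) c s, hcs, one_smul]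

/-- Givens rotations in the `(1, 2)`-plane preserve every alternating `4`-form. [folklore] -/
theorem _root_.AlternatingMap.map_frame_rot12 (vol : V [⋀^Fin 4]→ₗ[ℝ] W) (v : Fin 4 → V) {c s : ℝ}
    (hcs : c ^ 2 + s ^ 2 = 1) : vol ![v 0, c • v 1 + s • v 2, -s • v 1 + c • v 2, v 3] = vol v := by
  rw [frame_rot12_eq_update, vol.map_update_rotate v (by decide) c s, hcs, one_smul]

/-- Givens rotations in the `(0, 1)`-plane preserve every alternating `4`-form. [folklore] -/
theorem _root_.AlternatingMap.map_frame_rot01 (vol : V [⋀^Fin 4]→ₗ[ℝ] W) (v : Fin 4 → V) {c s : ℝ}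
    (hcs : c ^ 2 + s ^ 2 = 1) : vol ![c • v 0 + s • v 1, -s • v 0 + c • v 1, v 2, v 3] = vol v := by
  rw [frame_rot01_eq_update, vol.map_update_rotate v (by decide) c s, hcs, one_smul]

/-- **The two Givens parameters annihilating a coordinate**: for all real `a, b` there is a point
`(c, s)` of the unit circle with `c a + s b = 0` and `-s a + c b ≥ 0` (namely `(b, -a)/√(a² + b²)`,
or `(1, 0)` if `a = b = 0`; then `-s a + c b = √(a² + b²)`). [folklore] -/
theorem exists_circle_annihilate (a b : ℝ) :
    ∃ c s : ℝ, c ^ 2 + s ^ 2 = 1 ∧ c * a + s * b = 0 ∧ 0 ≤ -s * a + c * b := by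
  by_cases h : a ^ 2 + b ^ 2 = 0
  · have ha : a = 0 := by nlinarith [sq_nonneg a, sq_nonneg b]
    have hb : b = 0 := by nlinarith [sq_nonneg a, sq_nonneg b]
    exact ⟨1, 0, by norm_num, by simp [ha, hb], by simp [ha, hb]⟩
  · have hpos : 0 < a ^ 2 + b ^ 2 := lt_of_le_of_ne (by positivity) (Ne.symm h)
    set r := Real.sqrt (a ^ 2 + b ^ 2) with hr
    have hr0 : 0 < r := Real.sqrt_pos.2 hpos
    have hr2 : r ^ 2 = a ^ 2 + b ^ 2 := Real.sq_sqrt hpos.le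
    refine ⟨b / r, -a / r, ?_, ?_, ?_⟩
    · field_simp
      linarith [hr2]
    · field_simp
      ring
    · have : -(-a / r) * a + b / r * b = r := by
        field_simp
        linarith [hr2]
      rw [this]
      exact hr0.le

end Alternating

/-! ### Coordinates in an orthonormal frame -/

section Coordinates

variable {E : Type*} [NormedAddCommGroup E] [NormedSpace ℝ E] {H : Type*} [TopologicalSpace H]
  {I : ModelWithCorners ℝ E H} {M : Type*} [TopologicalSpace M] [ChartedSpace H M]
  [IsManifold I ∞ M] {n : ℕ∞ω} [FiniteDimensional ℝ E]
  {g : PseudoRiemannianMetric I n E (TangentSpace I : M → Type _)}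

/-- **Expansion in an orthonormal frame**: if `dim E = 4` and `f` is a `g_x`-orthonormal 4-frame,
then `f` is a basis of `T_x M` and `v = Σᵢ g_x(v, fᵢ) fᵢ` for every `v` (orthonormal vectors are
linearly independent; O'Neill 1983, Ch. 2, Lemma 2.24 ff.). [folklore] -/
theorem _root_.Literature.Geometry.Lorentzian.PseudoRiemannianMetric.IsOrthonormalFrame.eq_sum_smul (hE : finrank ℝ E = 4) {x : M}
    {f : Fin 4 → TangentSpace I x} (hf : g.IsOrthonormalFrame x f) (v : TangentSpace I x) :
    v = ∑ i, g.val x v (f i) • f i := by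
  have hδ : ∀ i j, g.val x (f i) (f j) = if i = j then 1 else 0 := fun i j ↦ by
    split_ifs with hij
    · subst hij
      exact hf.1 i
    · exact hf.2 i j hij
  -- coordinates of a combination
  have hco : ∀ (a : Fin 4 → ℝ) (j : Fin 4), g.val x (f j) (∑ i, a i • f i) = a j := fun a j ↦ by
    simp only [map_sum, map_smul, smul_eq_mul, hδ]
    simp [Finset.sum_ite_eq]
  have hli : LinearIndependent ℝ f := by
    rw [Fintype.linearIndependent_iff]
    intro a ha j
    have := hco a j
    rw [ha, map_zero] at this
    exact this.symm
  haveI : FiniteDimensional ℝ (TangentSpace I x) := ‹FiniteDimensional ℝ E›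
  have hcard : Fintype.card (Fin 4) = finrank ℝ (TangentSpace I x) := by
    rw [Fintype.card_fin]
    exact hE.symm
  have hsp : Submodule.span ℝ (Set.range f) = ⊤ := hli.span_eq_top_of_card_eq_finrank' hcard
  obtain ⟨a, ha⟩ := (Submodule.mem_span_range_iff_exists_fun ℝ).1
    (show v ∈ Submodule.span ℝ (Set.range f) from hsp ▸ Submodule.mem_top)
  have hcoef : ∀ j, a j = g.val x v (f j) := fun j ↦ by
    rw [g.symm x v (f j), ← ha, hco a j]
  calc v = ∑ i, a i • f i := ha.symm
    _ = ∑ i, g.val x v (f i) • f i := by simp only [hcoef]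

/-- In an orthonormal frame of a `4`-dimensional tangent space, a unit vector orthogonal to all
frame vectors but `f k` and pairing non-negatively with `f k` IS `f k`. [folklore] -/
theorem _root_.Literature.Geometry.Lorentzian.PseudoRiemannianMetric.IsOrthonormalFrame.eq_of_coords (hE : finrank ℝ E = 4) {x : M}
    {f : Fin 4 → TangentSpace I x} (hf : g.IsOrthonormalFrame x f) {v : TangentSpace I x}
    (hv : g.val x v v = 1) (k : Fin 4) (h0 : ∀ j, j ≠ k → g.val x v (f j) = 0)
    (hk : 0 ≤ g.val x v (f k)) : v = f k := by
  have hexp : v = g.val x v (f k) • f k := by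
    calc v = ∑ i, g.val x v (f i) • f i := hf.eq_sum_smul hE v
      _ = g.val x v (f k) • f k := by
        rw [Finset.sum_eq_single k (fun j _ hj ↦ by rw [h0 j hj, zero_smul])
          (fun hk' ↦ absurd (Finset.mem_univ k) hk')]
  have hsq : g.val x v (f k) * g.val x v (f k) = 1 := by
    have h1 := hv
    rw [hexp] at h1
    simpa only [map_smul, _root_.smul_apply, smul_eq_mul, hf.1 k, mul_one] using h1
  rcases mul_self_eq_one_iff.1 hsq with h1 | h1
  · rw [hexp, h1, one_smul]
  · exfalso
    linarith

/-- Sign-ambiguous version: a unit vector orthogonal to all frame vectors but `f k` is `± f k`.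
[folklore] -/
theorem _root_.Literature.Geometry.Lorentzian.PseudoRiemannianMetric.IsOrthonormalFrame.eq_or_eq_neg_of_coords (hE : finrank ℝ E = 4) {x : M}
    {f : Fin 4 → TangentSpace I x} (hf : g.IsOrthonormalFrame x f) {v : TangentSpace I x}
    (hv : g.val x v v = 1) (k : Fin 4) (h0 : ∀ j, j ≠ k → g.val x v (f j) = 0) :
    v = f k ∨ v = -f k := by
  have hexp : v = g.val x v (f k) • f k := by
    calc v = ∑ i, g.val x v (f i) • f i := hf.eq_sum_smul hE v
      _ = g.val x v (f k) • f k := by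
        rw [Finset.sum_eq_single k (fun j _ hj ↦ by rw [h0 j hj, zero_smul])
          (fun hk' ↦ absurd (Finset.mem_univ k) hk')]
  have hsq : g.val x v (f k) * g.val x v (f k) = 1 := by
    have h1 := hv
    rw [hexp] at h1
    simpa only [map_smul, _root_.smul_apply, smul_eq_mul, hf.1 k, mul_one] using h1
  rcases mul_self_eq_one_iff.1 hsq with h1 | h1
  · left
    rw [hexp, h1, one_smul]
  · right
    rw [hexp, h1, neg_one_smul]

end Coordinates

/-! ### Joining two like-oriented orthonormal frames by Givens rotations -/

section Chain

variable {E : Type*} [NormedAddCommGroup E] [NormedSpace ℝ E] {H : Type*} [TopologicalSpace H]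
  {I : ModelWithCorners ℝ E H} {M : Type*} [TopologicalSpace M] [ChartedSpace H M]
  [IsManifold I ∞ M] {n : ℕ∞ω} [FiniteDimensional ℝ E] [CompleteSpace E]
  {g : PseudoRiemannianMetric I n E (TangentSpace I : M → Type _)}
  {cov : CovariantDerivative I E (TangentSpace I : M → Type _)}

/-- The rotation matrix of `blockC_frame_rot23` is orthogonal. [folklore] -/
private theorem rot_first_mul_transpose {c s : ℝ} (hcs : c ^ 2 + s ^ 2 = 1) :
    !![1, 0, 0; 0, c, -s; 0, s, c] * (!![1, 0, 0; 0, c, -s; 0, s, c])ᵀ =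
      (1 : Matrix (Fin 3) (Fin 3) ℝ) := by
  ext i j
  fin_cases i <;> fin_cases j <;> simp [Matrix.mul_apply, Fin.sum_univ_three] <;> nlinarith [hcs]

/-- The rotation matrix of `blockC_frame_rot12` is orthogonal. [folklore] -/
private theorem rot_third_mul_transpose {c s : ℝ} (hcs : c ^ 2 + s ^ 2 = 1) :
    !![c, -s, 0; s, c, 0; 0, 0, 1] * (!![c, -s, 0; s, c, 0; 0, 0, 1])ᵀ =
      (1 : Matrix (Fin 3) (Fin 3) ℝ) := by
  ext i j
  fin_cases i <;> fin_cases j <;> simp [Matrix.mul_apply, Fin.sum_univ_three] <;> nlinarith [hcs]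

/-- The rotation matrix of `blockC_frame_rot01` is orthogonal. [folklore] -/
private theorem rot_first'_mul_transpose {c s : ℝ} (hcs : c ^ 2 + s ^ 2 = 1) :
    !![1, 0, 0; 0, c, s; 0, -s, c] * (!![1, 0, 0; 0, c, s; 0, -s, c])ᵀ =
      (1 : Matrix (Fin 3) (Fin 3) ℝ) := by
  ext i j
  fin_cases i <;> fin_cases j <;> simp [Matrix.mul_apply, Fin.sum_univ_three] <;> nlinarith [hcs]

/-- Composing orthogonal conjugations. [folklore] -/
private theorem conj_compose {C Ce P ρ : Matrix (Fin 3) (Fin 3) ℝ} (hP : P * Pᵀ = 1)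
    (hρ : ρ * ρᵀ = 1) (hC : C = Pᵀ * Ce * P) :
    (P * ρ) * (P * ρ)ᵀ = 1 ∧ ρᵀ * C * ρ = (P * ρ)ᵀ * Ce * (P * ρ) := by
  refine ⟨?_, ?_⟩
  · rw [Matrix.transpose_mul, Matrix.mul_assoc, ← Matrix.mul_assoc ρ, hρ, Matrix.one_mul, hP]
  · rw [hC, Matrix.transpose_mul]
    simp only [Matrix.mul_assoc]

/-- **Givens step in the `(0, 1)`-plane** along a chain of frames starting at `e`: orthonormality,
the value of an alternating `4`-form `vol` and "the block `C` is orthogonally conjugate to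
`C(e)`" are passed on to the rotated frame. [cite: Hamilton1997, §1.2, p. 5] -/
theorem givens_step01 (h : g.IsLeviCivita cov) (hn : 2 ≤ n) (x : M) (vol : TangentSpace I x [⋀^Fin 4]→ₗ[ℝ] ℝ)
    {e f : Fin 4 → TangentSpace I x} (hf : g.IsOrthonormalFrame x f) (hvf : vol f = vol e)
    (hP : ∃ P : Matrix (Fin 3) (Fin 3) ℝ, P * Pᵀ = 1 ∧
      g.blockC cov x f = Pᵀ * g.blockC cov x e * P)
    {c s : ℝ} (hcs : c ^ 2 + s ^ 2 = 1) :
    ∃ f' : Fin 4 → TangentSpace I x, g.IsOrthonormalFrame x f' ∧ vol f' = vol e ∧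
      (∃ P : Matrix (Fin 3) (Fin 3) ℝ, P * Pᵀ = 1 ∧
        g.blockC cov x f' = Pᵀ * g.blockC cov x e * P) ∧
      f' 0 = c • f 0 + s • f 1 ∧ f' 1 = -s • f 0 + c • f 1 ∧ f' 2 = f 2 ∧ f' 3 = f 3 := by
  obtain ⟨P, hPP, hC⟩ := hP
  obtain ⟨h1, h2⟩ := conj_compose hPP (rot_first'_mul_transpose hcs) hC
  exact ⟨![c • f 0 + s • f 1, -s • f 0 + c • f 1, f 2, f 3], hf.frame_rot01 hcs,
    by rw [vol.map_frame_rot01 f hcs, hvf], ⟨_, h1, by rw [blockC_frame_rot01 h hn x f hcs, h2]⟩,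
    rfl, rfl, rfl, rfl⟩

/-- **Givens step in the `(1, 2)`-plane** along a chain of frames starting at `e`.
[cite: Hamilton1997, §1.2, p. 5] -/
theorem givens_step12 (h : g.IsLeviCivita cov) (hn : 2 ≤ n) (x : M) (vol : TangentSpace I x [⋀^Fin 4]→ₗ[ℝ] ℝ)
    {e f : Fin 4 → TangentSpace I x} (hf : g.IsOrthonormalFrame x f) (hvf : vol f = vol e)
    (hP : ∃ P : Matrix (Fin 3) (Fin 3) ℝ, P * Pᵀ = 1 ∧
      g.blockC cov x f = Pᵀ * g.blockC cov x e * P)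
    {c s : ℝ} (hcs : c ^ 2 + s ^ 2 = 1) :
    ∃ f' : Fin 4 → TangentSpace I x, g.IsOrthonormalFrame x f' ∧ vol f' = vol e ∧
      (∃ P : Matrix (Fin 3) (Fin 3) ℝ, P * Pᵀ = 1 ∧
        g.blockC cov x f' = Pᵀ * g.blockC cov x e * P) ∧
      f' 0 = f 0 ∧ f' 1 = c • f 1 + s • f 2 ∧ f' 2 = -s • f 1 + c • f 2 ∧ f' 3 = f 3 := by
  obtain ⟨P, hPP, hC⟩ := hP
  obtain ⟨h1, h2⟩ := conj_compose hPP (rot_third_mul_transpose hcs) hC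
  exact ⟨![f 0, c • f 1 + s • f 2, -s • f 1 + c • f 2, f 3], hf.frame_rot12 hcs,
    by rw [vol.map_frame_rot12 f hcs, hvf], ⟨_, h1, by rw [blockC_frame_rot12 h hn x f hcs, h2]⟩,
    rfl, rfl, rfl, rfl⟩

/-- **Givens step in the `(2, 3)`-plane** along a chain of frames starting at `e`.
[cite: Hamilton1997, §1.2, p. 5] -/
theorem givens_step23 (h : g.IsLeviCivita cov) (hn : 2 ≤ n) (x : M) (vol : TangentSpace I x [⋀^Fin 4]→ₗ[ℝ] ℝ)
    {e f : Fin 4 → TangentSpace I x} (hf : g.IsOrthonormalFrame x f) (hvf : vol f = vol e)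
    (hP : ∃ P : Matrix (Fin 3) (Fin 3) ℝ, P * Pᵀ = 1 ∧
      g.blockC cov x f = Pᵀ * g.blockC cov x e * P)
    {c s : ℝ} (hcs : c ^ 2 + s ^ 2 = 1) :
    ∃ f' : Fin 4 → TangentSpace I x, g.IsOrthonormalFrame x f' ∧ vol f' = vol e ∧
      (∃ P : Matrix (Fin 3) (Fin 3) ℝ, P * Pᵀ = 1 ∧
        g.blockC cov x f' = Pᵀ * g.blockC cov x e * P) ∧
      f' 0 = f 0 ∧ f' 1 = f 1 ∧ f' 2 = c • f 2 + s • f 3 ∧ f' 3 = -s • f 2 + c • f 3 := by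
  obtain ⟨P, hPP, hC⟩ := hP
  obtain ⟨h1, h2⟩ := conj_compose hPP (rot_first_mul_transpose hcs) hC
  exact ⟨![f 0, f 1, c • f 2 + s • f 3, -s • f 2 + c • f 3], hf.frame_rot23 hcs,
    by rw [vol.map_frame_rot23 f hcs, hvf], ⟨_, h1, by rw [blockC_frame_rot23 h hn x f hcs, h2]⟩,
    rfl, rfl, rfl, rfl⟩

/-- **Two like-oriented orthonormal frames have orthogonally conjugate blocks `C`.** Let `cov`
be a Levi-Civita connection of the `C^n` metric `g` (`n ≥ 2`) on a manifold modelled on a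
`4`-dimensional space, and let `e`, `e'` be `g_x`-orthonormal 4-frames at `x` on which some
alternating `4`-form takes values of the same sign (i.e. bases of `T_x M` of the same orientation).
Then `C(e') = Pᵀ C(e) P` for an orthogonal `3 × 3` matrix `P` — the `SO(3)`-equivariance of the
`Λ²₋`-block of the curvature operator under `SO(4)` (Atiyah–Hitchin–Singer 1978, §1; Besse 1987,
1.126: the blocks are `SO(4)`-modules), proved frame-wise: `e'` is reached from `e` by six Givens
rotations in the coordinate planes `(0,1)`, `(1,2)`, `(2,3)` (each conjugating `C` by a rotation
of `ℝ³`: `blockC_frame_rot01/12/23`) followed, if the orientations differed, by the reversal of one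
vector — excluded here by the sign condition. [cite: Besse1987, 1.126–1.128] -/
theorem exists_blockC_eq_conj (h : g.IsLeviCivita cov) (hn : 2 ≤ n) (hE : finrank ℝ E = 4)
    (x : M) {e e' : Fin 4 → TangentSpace I x} (he : g.IsOrthonormalFrame x e)
    (he' : g.IsOrthonormalFrame x e') (vol : TangentSpace I x [⋀^Fin 4]→ₗ[ℝ] ℝ) (hvol : 0 < vol e * vol e') :
    ∃ P : Matrix (Fin 3) (Fin 3) ℝ, P * Pᵀ = 1 ∧
      g.blockC cov x e' = Pᵀ * g.blockC cov x e * P := by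
  have hP₀ : ∃ P : Matrix (Fin 3) (Fin 3) ℝ, P * Pᵀ = 1 ∧
      g.blockC cov x e = Pᵀ * g.blockC cov x e * P := ⟨1, by simp, by simp⟩
  have lin : ∀ (v X Y : TangentSpace I x) (a b : ℝ),
      g.val x v (a • X + b • Y) = a * g.val x v X + b * g.val x v Y := fun v X Y a b ↦ by
    rw [map_add, map_smul, map_smul, smul_eq_mul, smul_eq_mul]
  ---- Round 1: bring `e' 3` to the last position
  have R1 : ∃ f : Fin 4 → TangentSpace I x, g.IsOrthonormalFrame x f ∧ vol f = vol e ∧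
      (∃ P : Matrix (Fin 3) (Fin 3) ℝ, P * Pᵀ = 1 ∧
        g.blockC cov x f = Pᵀ * g.blockC cov x e * P) ∧ f 3 = e' 3 := by
    set v := e' 3 with hv
    -- plane (0,1): kill the coordinate along `e 0`
    obtain ⟨c₁, s₁, hcs₁, k₁, -⟩ := exists_circle_annihilate (g.val x v (e 0)) (g.val x v (e 1))
    obtain ⟨f₁, of₁, vf₁, Pf₁, f₁0, f₁1, f₁2, f₁3⟩ := givens_step01 h hn x vol he rfl hP₀ hcs₁
    have a₁ : g.val x v (f₁ 0) = 0 := by rw [f₁0, lin]; exact k₁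
    -- plane (1,2): kill the coordinate along `f₁ 1`
    obtain ⟨c₂, s₂, hcs₂, k₂, -⟩ := exists_circle_annihilate (g.val x v (f₁ 1)) (g.val x v (f₁ 2))
    obtain ⟨f₂, of₂, vf₂, Pf₂, f₂0, f₂1, f₂2, f₂3⟩ := givens_step12 h hn x vol of₁ vf₁ Pf₁ hcs₂
    have b₀ : g.val x v (f₂ 0) = 0 := by rw [f₂0]; exact a₁
    have b₁ : g.val x v (f₂ 1) = 0 := by rw [f₂1, lin]; exact k₂
    -- plane (2,3): kill the coordinate along `f₂ 2`
    obtain ⟨c₃, s₃, hcs₃, k₃, p₃⟩ := exists_circle_annihilate (g.val x v (f₂ 2)) (g.val x v (f₂ 3))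
    obtain ⟨f₃, of₃, vf₃, Pf₃, f₃0, f₃1, f₃2, f₃3⟩ := givens_step23 h hn x vol of₂ vf₂ Pf₂ hcs₃
    have c₀' : g.val x v (f₃ 0) = 0 := by rw [f₃0]; exact b₀
    have c₁' : g.val x v (f₃ 1) = 0 := by rw [f₃1]; exact b₁
    have c₂' : g.val x v (f₃ 2) = 0 := by rw [f₃2, lin]; exact k₃
    have c₃' : 0 ≤ g.val x v (f₃ 3) := by rw [f₃3, lin]; exact p₃
    have hv3 : v = f₃ 3 := of₃.eq_of_coords hE (he'.1 3) 3 (fun j hj ↦ by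
      fin_cases j
      · exact c₀'
      · exact c₁'
      · exact c₂'
      · exact absurd rfl hj) c₃'
    exact ⟨f₃, of₃, vf₃, Pf₃, hv3.symm⟩
  ---- Round 2: bring `e' 2` to position `2`, keeping `e' 3`
  have R2 : ∃ f : Fin 4 → TangentSpace I x, g.IsOrthonormalFrame x f ∧ vol f = vol e ∧
      (∃ P : Matrix (Fin 3) (Fin 3) ℝ, P * Pᵀ = 1 ∧
        g.blockC cov x f = Pᵀ * g.blockC cov x e * P) ∧ f 2 = e' 2 ∧ f 3 = e' 3 := by
    obtain ⟨f, of, vf, Pf, hf3⟩ := R1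
    set v := e' 2 with hv
    have hv3 : g.val x v (f 3) = 0 := by rw [hf3]; exact he'.2 2 3 (by decide)
    -- plane (0,1)
    obtain ⟨c₁, s₁, hcs₁, k₁, -⟩ := exists_circle_annihilate (g.val x v (f 0)) (g.val x v (f 1))
    obtain ⟨f₁, of₁, vf₁, Pf₁, f₁0, f₁1, f₁2, f₁3⟩ := givens_step01 h hn x vol of vf Pf hcs₁
    have a₁ : g.val x v (f₁ 0) = 0 := by rw [f₁0, lin]; exact k₁
    -- plane (1,2)
    obtain ⟨c₂, s₂, hcs₂, k₂, p₂⟩ := exists_circle_annihilate (g.val x v (f₁ 1)) (g.val x v (f₁ 2))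
    obtain ⟨f₂, of₂, vf₂, Pf₂, f₂0, f₂1, f₂2, f₂3⟩ := givens_step12 h hn x vol of₁ vf₁ Pf₁ hcs₂
    have b₀ : g.val x v (f₂ 0) = 0 := by rw [f₂0]; exact a₁
    have b₁ : g.val x v (f₂ 1) = 0 := by rw [f₂1, lin]; exact k₂
    have b₂ : 0 ≤ g.val x v (f₂ 2) := by rw [f₂2, lin]; exact p₂
    have b₃ : g.val x v (f₂ 3) = 0 := by rw [f₂3, f₁3]; exact hv3
    have hv2 : v = f₂ 2 := of₂.eq_of_coords hE (he'.1 2) 2 (fun j hj ↦ by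
      fin_cases j
      · exact b₀
      · exact b₁
      · exact absurd rfl hj
      · exact b₃) b₂
    exact ⟨f₂, of₂, vf₂, Pf₂, hv2.symm, by rw [f₂3, f₁3, hf3]⟩
  ---- Round 3: bring `e' 1` to position `1`, keeping `e' 2`, `e' 3`
  have R3 : ∃ f : Fin 4 → TangentSpace I x, g.IsOrthonormalFrame x f ∧ vol f = vol e ∧
      (∃ P : Matrix (Fin 3) (Fin 3) ℝ, P * Pᵀ = 1 ∧
        g.blockC cov x f = Pᵀ * g.blockC cov x e * P) ∧
      f 1 = e' 1 ∧ f 2 = e' 2 ∧ f 3 = e' 3 := by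
    obtain ⟨f, of, vf, Pf, hf2, hf3⟩ := R2
    set v := e' 1 with hv
    have hv2 : g.val x v (f 2) = 0 := by rw [hf2]; exact he'.2 1 2 (by decide)
    have hv3 : g.val x v (f 3) = 0 := by rw [hf3]; exact he'.2 1 3 (by decide)
    obtain ⟨c₁, s₁, hcs₁, k₁, p₁⟩ := exists_circle_annihilate (g.val x v (f 0)) (g.val x v (f 1))
    obtain ⟨f₁, of₁, vf₁, Pf₁, f₁0, f₁1, f₁2, f₁3⟩ := givens_step01 h hn x vol of vf Pf hcs₁
    have a₀ : g.val x v (f₁ 0) = 0 := by rw [f₁0, lin]; exact k₁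
    have a₁ : 0 ≤ g.val x v (f₁ 1) := by rw [f₁1, lin]; exact p₁
    have a₂ : g.val x v (f₁ 2) = 0 := by rw [f₁2]; exact hv2
    have a₃ : g.val x v (f₁ 3) = 0 := by rw [f₁3]; exact hv3
    have hv1 : v = f₁ 1 := of₁.eq_of_coords hE (he'.1 1) 1 (fun j hj ↦ by
      fin_cases j
      · exact a₀
      · exact absurd rfl hj
      · exact a₂
      · exact a₃) a₁
    exact ⟨f₁, of₁, vf₁, Pf₁, hv1.symm, by rw [f₁2, hf2], by rw [f₁3, hf3]⟩
  ---- Round 4: the first vector is `± e' 0`; the sign is fixed by the orientation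
  obtain ⟨f, of, vf, Pf, hf1, hf2, hf3⟩ := R3
  have k1 : g.val x (e' 0) (f 1) = 0 := by rw [hf1]; exact he'.2 0 1 (by decide)
  have k2 : g.val x (e' 0) (f 2) = 0 := by rw [hf2]; exact he'.2 0 2 (by decide)
  have k3 : g.val x (e' 0) (f 3) = 0 := by rw [hf3]; exact he'.2 0 3 (by decide)
  rcases of.eq_or_eq_neg_of_coords hE (he'.1 0) 0 (fun j hj ↦ by
      fin_cases j
      · exact absurd rfl hj
      · exact k1
      · exact k2
      · exact k3) with h0 | h0
  · -- `e' = f`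
    have hef : e' = f := by
      funext k
      fin_cases k
      · exact h0
      · exact hf1.symm
      · exact hf2.symm
      · exact hf3.symm
    rw [hef]
    exact Pf
  · -- `e' 0 = -f 0`: the orientations differ, contradiction
    exfalso
    have hef : e' = update f 0 (-f 0) := by
      funext k
      by_cases hk : k = 0
      · subst hk
        rw [update_self]
        exact h0
      · rw [update_of_ne hk]
        fin_cases k
        · exact absurd rfl hk
        · exact hf1.symm
        · exact hf2.symm
        · exact hf3.symm
    have hve : vol e' = -vol e := by
      rw [hef, vol.map_update_neg, update_eq_self, vf]
    have : vol e * vol e' = -(vol e * vol e) := by rw [hve]; ring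
    rw [this] at hvol
    linarith [mul_self_nonneg (vol e)]

end Chain

/-! ### Scalar blocks stay scalar -/

/-- An orthogonal conjugate of a scalar `3 × 3` matrix is scalar (in the normal form
`C = (tr C / 3)·1` used by `IsSelfDualWith`). [folklore] -/
theorem _root_.Matrix.eq_trace_div_smul_one_of_conj {C C' P : Matrix (Fin 3) (Fin 3) ℝ}
    (hP : P * Pᵀ = 1) (h : C' = Pᵀ * C * P)
    (hC : C = (C.trace / 3) • (1 : Matrix (Fin 3) (Fin 3) ℝ)) :
    C' = (C'.trace / 3) • (1 : Matrix (Fin 3) (Fin 3) ℝ) := by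
  have hPtP : Pᵀ * P = 1 := mul_eq_one_comm.1 hP
  set t := C.trace / 3 with ht
  have hC' : C' = t • (1 : Matrix (Fin 3) (Fin 3) ℝ) := by
    rw [h, hC, Matrix.mul_smul, Matrix.mul_one, Matrix.smul_mul, hPtP]
  have htr : C'.trace / 3 = t := by
    rw [hC', Matrix.trace_smul, Matrix.trace_one, Fintype.card_fin, smul_eq_mul]
    push_cast
    ring
  rw [htr, hC']

section ScalarTransfer

variable {E : Type*} [NormedAddCommGroup E] [NormedSpace ℝ E] {H : Type*} [TopologicalSpace H]
  {I : ModelWithCorners ℝ E H} {M : Type*} [TopologicalSpace M] [ChartedSpace H M]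
  [IsManifold I ∞ M] {n : ℕ∞ω} [FiniteDimensional ℝ E] [CompleteSpace E]
  {g : PseudoRiemannianMetric I n E (TangentSpace I : M → Type _)}
  {cov : CovariantDerivative I E (TangentSpace I : M → Type _)}

/-- **If `C` is scalar in one orthonormal frame, it is scalar in every like-oriented orthonormal
frame at the same point** (`W⁻(x) = 0` does not depend on the positive orthonormal frame used to
test it): general model space of dimension `4`, any Levi-Civita connection of a `C^n` metric,
`n ≥ 2`, orientation compared through any alternating `4`-form. [cite: Besse1987, 1.126–1.128] -/
theorem blockC_eq_trace_div_smul_one_of_sameOrientation (h : g.IsLeviCivita cov) (hn : 2 ≤ n)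
    (hE : finrank ℝ E = 4) (x : M) {e e' : Fin 4 → TangentSpace I x}
    (he : g.IsOrthonormalFrame x e) (he' : g.IsOrthonormalFrame x e')
    (vol : TangentSpace I x [⋀^Fin 4]→ₗ[ℝ] ℝ) (hvol : 0 < vol e * vol e')
    (hC : g.blockC cov x e = ((g.blockC cov x e).trace / 3) • (1 : Matrix (Fin 3) (Fin 3) ℝ)) :
    g.blockC cov x e' = ((g.blockC cov x e').trace / 3) • (1 : Matrix (Fin 3) (Fin 3) ℝ) := by
  obtain ⟨P, hP, hC'⟩ := exists_blockC_eq_conj h hn hE x he he' vol hvol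
  exact Matrix.eq_trace_div_smul_one_of_conj hP hC' hC

end ScalarTransfer

/-! ### Four-manifolds: one positive orthonormal frame per point suffices -/

section FourManifold

open Literature.Topology.FourManifolds (SmoothOrientation)
open Literature.Topology.FourManifolds

variable {M : Type*} [TopologicalSpace M] [ChartedSpace (EuclideanSpace ℝ (Fin 4)) M]
  [IsManifold (𝓡 4) ∞ M]
  {g : PseudoRiemannianMetric (𝓡 4) ∞ (EuclideanSpace ℝ (Fin 4)) (TangentSpace (𝓡 4) : M → Type _)}

/-- **The orientation character as an alternating form.** At each point there is an alternating
`4`-form `vol` on `T_x M` (the determinant in the reference basis of `ℝ⁴`, reindexed by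
`Fin 4 = Fin (finrank ℝ ℝ⁴)`) which is positive on the product of any two frames that are
positively oriented for the same orientation `o` (`SmoothOrientation.IsPosFrame`:
`0 < sign o x · det`, and `sign² = 1`). [folklore] -/
theorem exists_alternating_pos_of_isPosFrame (o : SmoothOrientation (𝓡 4) M) (x : M) :
    ∃ vol : TangentSpace (𝓡 4) x [⋀^Fin 4]→ₗ[ℝ] ℝ, ∀ e e' : Fin 4 → TangentSpace (𝓡 4) x,
      o.IsPosFrame x (frameOfFin e) → o.IsPosFrame x (frameOfFin e') → 0 < vol e * vol e' := by
  refine ⟨((finBasis ℝ (EuclideanSpace ℝ (Fin 4))).det.domDomCongr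
    (finCongr (finrank_euclideanSpace_fin (𝕜 := ℝ) (n := 4))) :
      EuclideanSpace ℝ (Fin 4) [⋀^Fin 4]→ₗ[ℝ] ℝ), fun e e' he he' ↦ ?_⟩
  -- `vol f` is `det (frameOfFin f)` by `rfl` (`finCongr h i = Fin.cast h i`)
  have h1 := mul_pos he he'
  rw [mul_mul_mul_comm, o.sign_mul_self, one_mul] at h1
  exact h1

/-- **Frame independence of `W⁻(x) = 0`.** On a smooth 4-manifold, for a Levi-Civita connection
`cov` of the metric `g` and an orientation `o`: if Hamilton's block `C` is scalar in ONE
positively oriented `g`-orthonormal frame at `x`, it is scalar in EVERY positively oriented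
`g`-orthonormal frame at `x` (the `Λ²₋`-block of the curvature operator is an `SO(4)`-module,
Besse 1987, 1.126–1.128; Atiyah–Hitchin–Singer 1978, §1). [cite: Besse1987, 1.126–1.128] -/
theorem blockC_eq_trace_div_smul_one_of_isPosFrame
    (cov : CovariantDerivative (𝓡 4) (EuclideanSpace ℝ (Fin 4)) (TangentSpace (𝓡 4) : M → Type _))
    (hcov : g.IsLeviCivita cov) (o : SmoothOrientation (𝓡 4) M) (x : M)
    {e e' : Fin 4 → TangentSpace (𝓡 4) x} (he : g.IsOrthonormalFrame x e)
    (he' : g.IsOrthonormalFrame x e') (ho : o.IsPosFrame x (frameOfFin e))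
    (ho' : o.IsPosFrame x (frameOfFin e'))
    (hC : g.blockC cov x e = ((g.blockC cov x e).trace / 3) • (1 : Matrix (Fin 3) (Fin 3) ℝ)) :
    g.blockC cov x e' = ((g.blockC cov x e').trace / 3) • (1 : Matrix (Fin 3) (Fin 3) ℝ) := by
  obtain ⟨vol, hvol⟩ := exists_alternating_pos_of_isPosFrame o x
  have hn : (2 : ℕ∞ω) ≤ ∞ := WithTop.coe_le_coe.mpr le_top
  exact blockC_eq_trace_div_smul_one_of_sameOrientation hcov hn finrank_euclideanSpace_fin x he he'
    vol (hvol e e' ho ho') hC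

/-- **Frame independence of `W⁺(x) = 0`** (the block `A`): the same statement for Hamilton's
block `A`, by reversing the orientation (`e ↦ e ∘ (2 3)` exchanges `A` and `C` up to reindexing,
`blockC_comp_swap`; AHS 1978, §1). [cite: Besse1987, 1.126–1.128] -/
theorem blockA_eq_trace_div_smul_one_of_isPosFrame
    (cov : CovariantDerivative (𝓡 4) (EuclideanSpace ℝ (Fin 4)) (TangentSpace (𝓡 4) : M → Type _))
    (hcov : g.IsLeviCivita cov) (o : SmoothOrientation (𝓡 4) M) (x : M)
    {e e' : Fin 4 → TangentSpace (𝓡 4) x} (he : g.IsOrthonormalFrame x e)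
    (he' : g.IsOrthonormalFrame x e') (ho : o.IsPosFrame x (frameOfFin e))
    (ho' : o.IsPosFrame x (frameOfFin e'))
    (hA : g.blockA cov x e = ((g.blockA cov x e).trace / 3) • (1 : Matrix (Fin 3) (Fin 3) ℝ)) :
    g.blockA cov x e' = ((g.blockA cov x e').trace / 3) • (1 : Matrix (Fin 3) (Fin 3) ℝ) := by
  have he₁ := he.comp_equiv (Equiv.swap (2 : Fin 4) 3)
  have he₁' := he'.comp_equiv (Equiv.swap (2 : Fin 4) 3)
  have ho₁ : (-o).IsPosFrame x (frameOfFin (e ∘ Equiv.swap (2 : Fin 4) 3)) := by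
    rw [SmoothOrientation.isPosFrame_neg_iff, det_frameOfFin_comp_swap, mul_neg, neg_neg]
    exact ho
  have ho₁' : (-o).IsPosFrame x (frameOfFin (e' ∘ Equiv.swap (2 : Fin 4) 3)) := by
    rw [SmoothOrientation.isPosFrame_neg_iff, det_frameOfFin_comp_swap, mul_neg, neg_neg]
    exact ho'
  have hC : g.blockC cov x (e ∘ Equiv.swap (2 : Fin 4) 3) =
      ((g.blockC cov x (e ∘ Equiv.swap (2 : Fin 4) 3)).trace / 3) •
        (1 : Matrix (Fin 3) (Fin 3) ℝ) := by
    rw [blockC_comp_swap]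
    exact (Matrix.submatrix_eq_trace_div_smul_one_iff _ _ 3).2 hA
  have key := blockC_eq_trace_div_smul_one_of_isPosFrame cov hcov (-o) x he₁ he₁' ho₁ ho₁' hC
  rw [blockC_comp_swap] at key
  exact (Matrix.submatrix_eq_trace_div_smul_one_iff _ _ 3).1 key

/-- **One positive orthonormal frame per point suffices** (general connection): if at every
point SOME positively oriented `g`-orthonormal frame has scalar block `C`, then `g` is self-dual
for `o` with respect to `cov` in the sense of `IsSelfDualWithOf` (every positive orthonormal
frame). [cite: AtiyahHitchinSinger1978, §1] -/
theorem _root_.Literature.Geometry.Lorentzian.PseudoRiemannianMetric.isSelfDualWithOf_of_forall_exists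
    (cov : CovariantDerivative (𝓡 4) (EuclideanSpace ℝ (Fin 4)) (TangentSpace (𝓡 4) : M → Type _))
    (hcov : g.IsLeviCivita cov) (o : SmoothOrientation (𝓡 4) M)
    (h : ∀ x : M, ∃ e : Fin 4 → TangentSpace (𝓡 4) x, g.IsOrthonormalFrame x e ∧
      o.IsPosFrame x (frameOfFin e) ∧
        g.blockC cov x e = ((g.blockC cov x e).trace / 3) • (1 : Matrix (Fin 3) (Fin 3) ℝ)) :
    g.IsSelfDualWithOf cov o := by
  intro x e' he' ho'
  obtain ⟨e, he, ho, hC⟩ := h x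
  exact blockC_eq_trace_div_smul_one_of_isPosFrame cov hcov o x he he' ho ho' hC

/-- Dually: if at every point some positively `o`-oriented orthonormal frame has scalar block
`A`, then `g` is self-dual for `-o` (anti-self-dual for `o`) with respect to `cov`.
[cite: AtiyahHitchinSinger1978, §1] -/
theorem _root_.Literature.Geometry.Lorentzian.PseudoRiemannianMetric.isSelfDualWithOf_neg_of_forall_exists
    (cov : CovariantDerivative (𝓡 4) (EuclideanSpace ℝ (Fin 4)) (TangentSpace (𝓡 4) : M → Type _))
    (hcov : g.IsLeviCivita cov) (o : SmoothOrientation (𝓡 4) M)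
    (h : ∀ x : M, ∃ e : Fin 4 → TangentSpace (𝓡 4) x, g.IsOrthonormalFrame x e ∧
      o.IsPosFrame x (frameOfFin e) ∧
        g.blockA cov x e = ((g.blockA cov x e).trace / 3) • (1 : Matrix (Fin 3) (Fin 3) ℝ)) :
    g.IsSelfDualWithOf cov (-o) := by
  rw [isSelfDualWithOf_neg_iff]
  intro x e' he' ho'
  obtain ⟨e, he, ho, hA⟩ := h x
  exact blockA_eq_trace_div_smul_one_of_isPosFrame cov hcov o x he he' ho ho' hA

/-- Linear independence of an orthonormal `4`-frame (a private copy; the general statement is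
`IsOrthonormalFrame.linearIndependent` of `ChangGurskyYangProofs.lean`, not imported here).
[folklore] -/
private theorem linearIndependent_of_isOrthonormalFrame {x : M} {e : Fin 4 → TangentSpace (𝓡 4) x}
    (he : g.IsOrthonormalFrame x e) : LinearIndependent ℝ e := by
  have hδ : ∀ i j, g.val x (e i) (e j) = if i = j then 1 else 0 := fun i j ↦ by
    split_ifs with hij
    · subst hij
      exact he.1 i
    · exact he.2 i j hij
  rw [Fintype.linearIndependent_iff]
  intro a ha j
  have hco : g.val x (e j) (∑ i, a i • e i) = a j := by
    simp only [map_sum, map_smul, smul_eq_mul, hδ]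
    simp [Finset.sum_ite_eq]
  rw [ha, map_zero] at hco
  exact hco.symm

/-- **Positive orthonormal frames exist** at every point of an oriented Riemannian 4-manifold:
take a `g_x`-orthonormal basis (`PseudoRiemannianMetric.exists_orthonormal_basis`) and, if it is
negatively oriented, reverse its last vector. [folklore] -/
theorem exists_isOrthonormalFrame_isPosFrame (hg : g.IsRiemannian) (o : SmoothOrientation (𝓡 4) M)
    (x : M) : ∃ e : Fin 4 → TangentSpace (𝓡 4) x,
      g.IsOrthonormalFrame x e ∧ o.IsPosFrame x (frameOfFin e) := by
  obtain ⟨b, hb⟩ := g.exists_orthonormal_basis x hg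
  have h4 : finrank ℝ (TangentSpace (𝓡 4) x) = 4 := finrank_euclideanSpace_fin
  set e : Fin 4 → TangentSpace (𝓡 4) x := fun k ↦ b (Fin.cast h4.symm k) with hedef
  have he : g.IsOrthonormalFrame x e := by
    refine ⟨fun k ↦ ?_, fun k l hkl ↦ ?_⟩
    · simp only [hedef, hb, if_true]
    · simp only [hedef, hb]
      rw [if_neg]
      exact fun h' ↦ hkl (Fin.cast_injective _ h')
  by_cases ho : o.IsPosFrame x (frameOfFin e)
  · exact ⟨e, he, ho⟩
  · refine ⟨update e 3 (-e 3), he.update_neg 3, ?_⟩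
    set h := (finrank_euclideanSpace_fin : finrank ℝ (EuclideanSpace ℝ (Fin 4)) = 4) with hh
    have hli : LinearIndependent ℝ (frameOfFin e) :=
      (linearIndependent_of_isOrthonormalFrame he).comp _ (Fin.cast_injective h)
    have hdet : (finBasis ℝ (EuclideanSpace ℝ (Fin 4))).det (frameOfFin e) ≠ 0 :=
      det_ne_zero_of_linearIndependent _ hli
    have key : frameOfFin (update e 3 (-e 3)) =
        update (frameOfFin e) (Fin.cast h.symm 3) (-(frameOfFin e (Fin.cast h.symm 3))) :=
      update_comp_eq_of_injective e (Fin.cast_injective h) (Fin.cast h.symm 3) (-e 3)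
    rw [key]
    exact (o.isPosFrame_update_neg_iff x hdet _).2 ho

/-- **Self-duality with respect to a connection, tested on one frame per point**: for a
Riemannian `g`, `g.IsSelfDualWithOf cov o` iff at every point there is a positively
`o`-oriented `g`-orthonormal frame in which the block `C` of the curvature of the Levi-Civita
connection `cov` is scalar. [cite: AtiyahHitchinSinger1978, §1] -/
theorem _root_.Literature.Geometry.Lorentzian.PseudoRiemannianMetric.isSelfDualWithOf_iff_forall_exists
    (hg : g.IsRiemannian)
    (cov : CovariantDerivative (𝓡 4) (EuclideanSpace ℝ (Fin 4)) (TangentSpace (𝓡 4) : M → Type _))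
    (hcov : g.IsLeviCivita cov) (o : SmoothOrientation (𝓡 4) M) :
    g.IsSelfDualWithOf cov o ↔
      ∀ x : M, ∃ e : Fin 4 → TangentSpace (𝓡 4) x, g.IsOrthonormalFrame x e ∧
        o.IsPosFrame x (frameOfFin e) ∧
          g.blockC cov x e = ((g.blockC cov x e).trace / 3) • (1 : Matrix (Fin 3) (Fin 3) ℝ) := by
  refine ⟨fun h x ↦ ?_, isSelfDualWithOf_of_forall_exists cov hcov o⟩
  obtain ⟨e, he, ho⟩ := exists_isOrthonormalFrame_isPosFrame hg o x
  exact ⟨e, he, ho, h x e he ho⟩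

variable [g.HasLeviCivita]

/-- **Self-duality is checked on one positive orthonormal frame per point** (Levi-Civita
connection `g.leviCivita`): if at every point some positively `o`-oriented `g`-orthonormal frame
has scalar block `C` (`C = (tr C/3)·1`, i.e. `W⁻(x) = 0`), then `g.IsSelfDualWith o`.
[cite: AtiyahHitchinSinger1978, §1] -/
theorem _root_.Literature.Geometry.Lorentzian.PseudoRiemannianMetric.isSelfDualWith_of_forall_exists
    (o : SmoothOrientation (𝓡 4) M)
    (h : ∀ x : M, ∃ e : Fin 4 → TangentSpace (𝓡 4) x, g.IsOrthonormalFrame x e ∧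
      o.IsPosFrame x (frameOfFin e) ∧
        g.blockC g.leviCivita x e =
          ((g.blockC g.leviCivita x e).trace / 3) • (1 : Matrix (Fin 3) (Fin 3) ℝ)) :
    g.IsSelfDualWith o :=
  isSelfDualWithOf_of_forall_exists g.leviCivita isLeviCivita_leviCivita_holds o h

/-- Anti-self-duality (`g.IsSelfDualWith (-o)`, `W⁺ ≡ 0`) is checked on one positively
`o`-oriented orthonormal frame per point through the block `A`. [cite: AtiyahHitchinSinger1978, §1] -/
theorem _root_.Literature.Geometry.Lorentzian.PseudoRiemannianMetric.isSelfDualWith_neg_of_forall_exists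
    (o : SmoothOrientation (𝓡 4) M)
    (h : ∀ x : M, ∃ e : Fin 4 → TangentSpace (𝓡 4) x, g.IsOrthonormalFrame x e ∧
      o.IsPosFrame x (frameOfFin e) ∧
        g.blockA g.leviCivita x e =
          ((g.blockA g.leviCivita x e).trace / 3) • (1 : Matrix (Fin 3) (Fin 3) ℝ)) :
    g.IsSelfDualWith (-o) :=
  isSelfDualWithOf_neg_of_forall_exists g.leviCivita isLeviCivita_leviCivita_holds o h

/-- **Frame independence of self-duality** (the form promised in `SelfDualMetric.lean`): for a
Riemannian metric `g` on an oriented smooth 4-manifold, `g.IsSelfDualWith o` (block `C` scalar in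
EVERY positive orthonormal frame, `W⁻ ≡ 0`) iff at every point SOME positively `o`-oriented
`g`-orthonormal frame has scalar block `C`. [cite: AtiyahHitchinSinger1978, §1]
[cite: Besse1987, 1.126–1.128] -/
theorem _root_.Literature.Geometry.Lorentzian.PseudoRiemannianMetric.isSelfDualWith_iff_forall_exists
    (hg : g.IsRiemannian) (o : SmoothOrientation (𝓡 4) M) :
    g.IsSelfDualWith o ↔
      ∀ x : M, ∃ e : Fin 4 → TangentSpace (𝓡 4) x, g.IsOrthonormalFrame x e ∧
        o.IsPosFrame x (frameOfFin e) ∧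
          g.blockC g.leviCivita x e =
            ((g.blockC g.leviCivita x e).trace / 3) • (1 : Matrix (Fin 3) (Fin 3) ℝ) :=
  isSelfDualWithOf_iff_forall_exists hg g.leviCivita isLeviCivita_leviCivita_holds o

/-- In a self-dual metric, scalar-ness of `C` at a point can be read off ANY positive orthonormal
frame; equivalently two positive orthonormal frames at a point agree on whether `C` is scalar.
[cite: Besse1987, 1.126–1.128] -/
theorem _root_.Literature.Geometry.Lorentzian.PseudoRiemannianMetric.blockC_eq_trace_div_smul_one_iff_of_isPosFrame
    (o : SmoothOrientation (𝓡 4) M) (x : M) {e e' : Fin 4 → TangentSpace (𝓡 4) x}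
    (he : g.IsOrthonormalFrame x e) (he' : g.IsOrthonormalFrame x e')
    (ho : o.IsPosFrame x (frameOfFin e)) (ho' : o.IsPosFrame x (frameOfFin e')) :
    g.blockC g.leviCivita x e =
        ((g.blockC g.leviCivita x e).trace / 3) • (1 : Matrix (Fin 3) (Fin 3) ℝ) ↔
      g.blockC g.leviCivita x e' =
        ((g.blockC g.leviCivita x e').trace / 3) • (1 : Matrix (Fin 3) (Fin 3) ℝ) :=
  ⟨blockC_eq_trace_div_smul_one_of_isPosFrame g.leviCivita isLeviCivita_leviCivita_holds o x he he'
      ho ho',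
    blockC_eq_trace_div_smul_one_of_isPosFrame g.leviCivita isLeviCivita_leviCivita_holds o x he' he
      ho' ho⟩

end FourManifold

end Literature.Geometry.Riemannian

end
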